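import Literature.Barriers.QuantumAdvantage.LatticeRigidity
import Mathlib.LinearAlgebra.Matrix.Permutation
import Mathlib.LinearAlgebra.Matrix.ToLin
import HarnessLib

/-!
# Lattice rigidity of the Toffoli+Hadamard gate group — generators of `O_N(ℤ[1/2])`

Support file for the discharge of `latticeRigidity_finiteImage` (`LatticeRigidity.lean`):
the three kinds of generators of `Γ_N = O_N(ℤ[1/2])` used by Amy–Glaudell–Ross' exact-synthesis
theorem [cite: AmyGlaudellRoss2020, §5.1, generators (−1)_[a], X_[a,b], (H⊗H)_[a,b,c,d]] —
one-level sign changes `negAt i`, permutation matrices `permOp σ`, and ONE four-level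
`H ⊗ H` block `hadamardBlock` on the coordinates `0,1,2,3` (the others are its conjugates by
permutation matrices) — together with their action on column vectors and the handful of relations
between them that the finiteness proof uses.
-/

noncomputable section

open Matrix Equiv

namespace Literature.Barriers.QuantumAdvantage

variable {N : ℕ}

/-! ### The underlying matrix -/

/-- The underlying rational matrix of an element of `Γ_N = O_N(ℤ[1/2])`, as a monoid homomorphism.
[cite: AmyGlaudellRoss2020, §5.1] -/
def toMat (N : ℕ) : dyadicOrthogonalGroup N →* Matrix (Fin N) (Fin N) ℚ :=
  (Matrix.orthogonalGroup (Fin N) ℚ).subtype.comp (dyadicOrthogonalGroup N).subtype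

/-- `toMat` is the double coercion. [cite: AmyGlaudellRoss2020, §5.1] -/
theorem toMat_apply (g : dyadicOrthogonalGroup N) :
    toMat N g = ((g : Matrix.orthogonalGroup (Fin N) ℚ) : Matrix (Fin N) (Fin N) ℚ) := rfl

/-- `toMat` of `mkOfMatrix`. [cite: AmyGlaudellRoss2020, §5.1] -/
@[simp] theorem toMat_mkOfMatrix (A : Matrix (Fin N) (Fin N) ℚ) (horth : A * Aᵀ = 1)
    (hdy : ∀ i j, A i j ∈ dyadicRationals) :
    toMat N (dyadicOrthogonalGroup.mkOfMatrix A horth hdy) = A := rfl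

/-- `toMat` is injective. [cite: AmyGlaudellRoss2020, §5.1] -/
theorem toMat_injective : Function.Injective (toMat N) := fun _ _ h =>
  Subtype.ext (Subtype.ext h)

/-- Entries of elements of `Γ_N` are dyadic. [cite: AmyGlaudellRoss2020, §5.1] -/
theorem toMat_mem_dyadicRationals (g : dyadicOrthogonalGroup N) (i j : Fin N) :
    toMat N g i j ∈ dyadicRationals := g.2 i j

/-- `A Aᵀ = 1`. [cite: AmyGlaudellRoss2020, §5.1] -/
theorem toMat_mul_transpose_self (g : dyadicOrthogonalGroup N) : toMat N g * (toMat N g)ᵀ = 1 :=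
  (Matrix.mem_orthogonalGroup_iff (Fin N) ℚ).1 g.1.2

/-- `Aᵀ A = 1`. [cite: AmyGlaudellRoss2020, §5.1] -/
theorem transpose_mul_toMat_self (g : dyadicOrthogonalGroup N) : (toMat N g)ᵀ * toMat N g = 1 :=
  (Matrix.mem_orthogonalGroup_iff' (Fin N) ℚ).1 g.1.2

/-- The inverse is the transpose. [cite: AmyGlaudellRoss2020, §5.1] -/
theorem toMat_inv (g : dyadicOrthogonalGroup N) : toMat N g⁻¹ = (toMat N g)ᵀ := by
  rw [toMat_apply, Subgroup.coe_inv, Matrix.UnitaryGroup.inv_val, ← toMat_apply]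
  change star (toMat N g) = _
  rw [Matrix.star_eq_conjTranspose, Matrix.conjTranspose_eq_transpose_of_trivial]

/-- Action of a product. [cite: AmyGlaudellRoss2020, §5.1] -/
theorem toMat_mul_mulVec (g h : dyadicOrthogonalGroup N) (v : Fin N → ℚ) :
    toMat N (g * h) *ᵥ v = toMat N g *ᵥ (toMat N h *ᵥ v) := by
  rw [map_mul, Matrix.mulVec_mulVec]

/-- `g⁻¹ (g v) = v`. [cite: AmyGlaudellRoss2020, §5.1] -/
theorem toMat_inv_mulVec_mulVec (g : dyadicOrthogonalGroup N) (v : Fin N → ℚ) :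
    toMat N g⁻¹ *ᵥ (toMat N g *ᵥ v) = v := by
  rw [← toMat_mul_mulVec, inv_mul_cancel, map_one, Matrix.one_mulVec]

/-- Elements of `Γ_N` preserve the dot product. [cite: AmyGlaudellRoss2020, §5.1] -/
theorem dotProduct_toMat_mulVec (g : dyadicOrthogonalGroup N) (u v : Fin N → ℚ) :
    (toMat N g *ᵥ u) ⬝ᵥ (toMat N g *ᵥ v) = u ⬝ᵥ v := by
  rw [Matrix.dotProduct_mulVec, ← Matrix.mulVec_transpose, Matrix.mulVec_mulVec,
    transpose_mul_toMat_self, Matrix.one_mulVec]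

/-- Two elements of `Γ_N` with the same action on column vectors are equal.
[cite: AmyGlaudellRoss2020, §5.1] -/
theorem ext_mulVec {g h : dyadicOrthogonalGroup N} (hgh : ∀ v, toMat N g *ᵥ v = toMat N h *ᵥ v) :
    g = h := by
  apply toMat_injective
  apply Matrix.toLin'.injective
  refine LinearMap.ext fun v => ?_
  simpa only [Matrix.toLin'_apply] using hgh v

/-! ### One-level sign changes `(−1)_[i]` -/

/-- The one-level sign change `(−1)_[i] = diag(1,…,1,−1,1,…,1)` (the `−1` in position `i`), an
element of `Γ_N`. [cite: AmyGlaudellRoss2020, §5.1, generator (−1)_[a]] -/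
def negAt (i : Fin N) : dyadicOrthogonalGroup N :=
  dyadicOrthogonalGroup.mkOfMatrix (Matrix.diagonal fun j => if j = i then (-1 : ℚ) else 1)
    (by
      rw [Matrix.diagonal_transpose, Matrix.diagonal_mul_diagonal, ← Matrix.diagonal_one]
      congr 1
      funext j
      split_ifs <;> norm_num)
    (by
      intro a b
      rw [Matrix.diagonal_apply]
      split_ifs
      · exact Subring.neg_mem _ (Subring.one_mem _)
      · exact Subring.one_mem _
      · exact Subring.zero_mem _)

/-- Action of `(−1)_[i]` on column vectors. [cite: AmyGlaudellRoss2020, §5.1] -/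
@[simp] theorem negAt_mulVec (i : Fin N) (v : Fin N → ℚ) (j : Fin N) :
    (toMat N (negAt i) *ᵥ v) j = if j = i then -v j else v j := by
  simp only [negAt, toMat_mkOfMatrix, Matrix.mulVec_diagonal]
  split_ifs <;> ring

/-- `(−1)_[i]` is an involution. [cite: AmyGlaudellRoss2020, §5.1] -/
theorem negAt_mul_self (i : Fin N) : negAt i * negAt i = 1 := by
  refine ext_mulVec fun v => funext fun j => ?_
  rw [toMat_mul_mulVec, negAt_mulVec, negAt_mulVec, map_one, Matrix.one_mulVec]
  split_ifs <;> ring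

/-- Sign changes commute. [cite: AmyGlaudellRoss2020, §5.1] -/
theorem negAt_comm (i i' : Fin N) : negAt i * negAt i' = negAt i' * negAt i := by
  refine ext_mulVec fun v => funext fun j => ?_
  simp only [toMat_mul_mulVec, negAt_mulVec]
  split_ifs <;> ring

/-! ### Permutation matrices `X_[a,b]` and their products -/

/-- The permutation matrix of `σ`, normalised so that `permOp σ • e_j = e_{σ j}` and
`σ ↦ permOp σ` is a homomorphism; an element of `Γ_N` (entries `0,1`).  The two-level generators
`X_[a,b]` of Amy–Glaudell–Ross are `permOp (swap a b)`. [cite: AmyGlaudellRoss2020, §5.1, generator X_[a,b]] -/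
def permOp : Equiv.Perm (Fin N) →* dyadicOrthogonalGroup N where
  toFun σ := dyadicOrthogonalGroup.mkOfMatrix ((σ⁻¹).permMatrix ℚ)
    (by
      rw [Matrix.transpose_permMatrix, inv_inv, ← Matrix.permMatrix_mul, mul_inv_cancel,
        Matrix.permMatrix_one])
    (by
      intro a b
      simp only [Equiv.Perm.permMatrix, PEquiv.toMatrix_apply]
      split_ifs
      exacts [Subring.one_mem _, Subring.zero_mem _])
  map_one' := by
    apply toMat_injective
    simp
  map_mul' σ τ := by
    apply toMat_injective
    rw [map_mul]
    simp only [toMat_mkOfMatrix, _root_.mul_inv_rev, Matrix.permMatrix_mul]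

/-- Action of a permutation matrix on column vectors: `(permOp σ • v) j = v (σ⁻¹ j)`.
[cite: AmyGlaudellRoss2020, §5.1] -/
@[simp] theorem permOp_mulVec (σ : Equiv.Perm (Fin N)) (v : Fin N → ℚ) (j : Fin N) :
    (toMat N (permOp σ) *ᵥ v) j = v (σ.symm j) := by
  show (((σ⁻¹).permMatrix ℚ) *ᵥ v) j = _
  rw [Matrix.permMatrix_mulVec]
  rfl

/-- `permOp σ • e_j = e_{σ j}`. [cite: AmyGlaudellRoss2020, §5.1] -/
theorem permOp_mulVec_single (σ : Equiv.Perm (Fin N)) (j : Fin N) :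
    toMat N (permOp σ) *ᵥ Pi.single j 1 = Pi.single (σ j) 1 := by
  funext i
  simp only [permOp_mulVec, Pi.single_apply, Equiv.symm_apply_eq]

/-- Conjugating a sign change by a permutation matrix: `P_σ (−1)_[i] = (−1)_[σ i] P_σ`.
[cite: AmyGlaudellRoss2020, §5.1] -/
theorem permOp_mul_negAt (σ : Equiv.Perm (Fin N)) (i : Fin N) :
    permOp σ * negAt i = negAt (σ i) * permOp σ := by
  refine ext_mulVec fun v => funext fun j => ?_
  simp only [toMat_mul_mulVec, negAt_mulVec, permOp_mulVec, Equiv.symm_apply_eq]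

/-- A permutation fixing `i` commutes with `(−1)_[i]`. [cite: AmyGlaudellRoss2020, §5.1] -/
theorem negAt_mul_permOp_of_apply_eq {σ : Equiv.Perm (Fin N)} {i : Fin N} (h : σ i = i) :
    negAt i * permOp σ = permOp σ * negAt i := by
  rw [permOp_mul_negAt, h]

/-! ### The four-level `H ⊗ H` block -/

/-- The sign pattern of `2 · (H ⊗ H)` (rows/columns indexed by `|00⟩,|01⟩,|10⟩,|11⟩`).
[folklore] -/
def hhSign : Fin 4 → Fin 4 → ℚ :=
  ![![1, 1, 1, 1], ![1, -1, 1, -1], ![1, 1, -1, -1], ![1, -1, -1, 1]]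

/-- `hhSign` is symmetric. [folklore] -/
theorem hhSign_symm (p q : Fin 4) : hhSign p q = hhSign q p := by
  fin_cases p <;> fin_cases q <;> rfl

/-- The entries of `hhSign` are `±1`. [folklore] -/
theorem hhSign_eq_one_or (p q : Fin 4) : hhSign p q = 1 ∨ hhSign p q = -1 := by
  fin_cases p <;> fin_cases q <;> simp [hhSign]

/-- `(2 H⊗H)² = 4`: row orthogonality of the sign pattern. [folklore] -/
theorem sum_hhSign_mul_hhSign (p r : Fin 4) :
    ∑ q, hhSign p q * hhSign q r = if p = r then 4 else 0 := by
  fin_cases p <;> fin_cases r <;> simp [hhSign, Fin.sum_univ_four] <;> norm_num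

/-- The matrix `(H ⊗ H) ⊕ 1_{N-4}`: the `H ⊗ H` block on the coordinates `0,1,2,3`, the identity
elsewhere (for `N < 4` a meaningless truncation, never used).
[cite: AmyGlaudellRoss2020, §5.1, generator (H⊗H)_[a,b,c,d]] -/
def hadamardMat (N : ℕ) : Matrix (Fin N) (Fin N) ℚ := Matrix.of fun i j =>
  if hi : i.val < 4 then (if hj : j.val < 4 then hhSign ⟨i.val, hi⟩ ⟨j.val, hj⟩ / 2 else 0)
  else (if i = j then 1 else 0)

/-- A sum over `Fin N` of a function supported on the first four coordinates is a sum over `Fin 4`.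
[folklore] -/
theorem sum_eq_sum_castLE (hN : 4 ≤ N) {M : Type*} [AddCommMonoid M] (f : Fin N → M)
    (hf : ∀ j : Fin N, ¬ j.val < 4 → f j = 0) :
    ∑ j, f j = ∑ q : Fin 4, f (Fin.castLE hN q) := by
  have h1 : ∑ q : Fin 4, f (Fin.castLE hN q) = ∑ j ∈ Finset.univ.map (Fin.castLEEmb hN), f j := by
    rw [Finset.sum_map]
    rfl
  rw [h1]
  refine (Finset.sum_subset (Finset.subset_univ _) fun j _ hj => hf j fun hj4 => hj ?_).symm
  exact Finset.mem_map.mpr ⟨⟨j.val, hj4⟩, Finset.mem_univ _, Fin.ext rfl⟩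

/-- A coordinate `≥ 4` is not one of the block coordinates. [folklore] -/
theorem ne_castLE_of_le (hN : 4 ≤ N) {j : Fin N} (hj : ¬ j.val < 4) (q : Fin 4) :
    j ≠ Fin.castLE hN q := fun h => hj (by rw [h, Fin.val_castLE]; exact q.isLt)

/-- Action of the `H ⊗ H` block on a block coordinate. [cite: AmyGlaudellRoss2020, Lemma 5.2] -/
theorem hadamardMat_mulVec_castLE (hN : 4 ≤ N) (v : Fin N → ℚ) (p : Fin 4) :
    (hadamardMat N *ᵥ v) (Fin.castLE hN p) = (∑ q : Fin 4, hhSign p q * v (Fin.castLE hN q)) / 2 := by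
  simp only [Matrix.mulVec, dotProduct, hadamardMat, Matrix.of_apply, Fin.val_castLE, Fin.is_lt,
    dif_pos, Fin.eta]
  rw [sum_eq_sum_castLE hN _ (fun j hj => by simp [hj]), Finset.sum_div]
  refine Finset.sum_congr rfl fun q _ => ?_
  simp only [Fin.val_castLE, Fin.is_lt, dif_pos, Fin.eta]
  ring

/-- Action of the `H ⊗ H` block off the block: identity. [cite: AmyGlaudellRoss2020, Lemma 5.2] -/
theorem hadamardMat_mulVec_of_not_lt {v : Fin N → ℚ} {j : Fin N} (hj : ¬ j.val < 4) :
    (hadamardMat N *ᵥ v) j = v j := by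
  simp only [Matrix.mulVec, dotProduct, hadamardMat, Matrix.of_apply, dif_neg hj, ite_mul, one_mul,
    zero_mul, Finset.sum_ite_eq, Finset.mem_univ, if_true]

/-- The block matrix is symmetric. [folklore] -/
theorem hadamardMat_transpose : (hadamardMat N)ᵀ = hadamardMat N := by
  ext i j
  simp only [Matrix.transpose_apply, hadamardMat, Matrix.of_apply]
  by_cases hi : i.val < 4 <;> by_cases hj : j.val < 4
  · simp only [dif_pos hi, dif_pos hj]
    rw [hhSign_symm]
  · have hne : j ≠ i := fun h => hj (h ▸ hi)
    simp [hi, hj, hne]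
  · have hne : i ≠ j := fun h => hi (h ▸ hj)
    simp [hi, hj, hne]
  · simp only [dif_neg hi, dif_neg hj, eq_comm]

/-- The block matrix is an involution (`N ≥ 4`). [folklore] -/
theorem hadamardMat_mulVec_mulVec (hN : 4 ≤ N) (v : Fin N → ℚ) :
    hadamardMat N *ᵥ (hadamardMat N *ᵥ v) = v := by
  funext j
  by_cases hj : j.val < 4
  · obtain ⟨p, rfl⟩ : ∃ p : Fin 4, Fin.castLE hN p = j := ⟨⟨j.val, hj⟩, Fin.ext rfl⟩
    rw [hadamardMat_mulVec_castLE hN]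
    simp only [hadamardMat_mulVec_castLE hN]
    fin_cases p <;> simp [hhSign, Fin.sum_univ_four] <;> ring
  · rw [hadamardMat_mulVec_of_not_lt hj, hadamardMat_mulVec_of_not_lt hj]

/-- `((H⊗H) ⊕ 1)² = 1` as matrices (`N ≥ 4`). [folklore] -/
theorem hadamardMat_mul_self (hN : 4 ≤ N) : hadamardMat N * hadamardMat N = 1 :=
  Matrix.toLin'.injective (LinearMap.ext fun v => by
    simp only [Matrix.toLin'_apply, ← Matrix.mulVec_mulVec, hadamardMat_mulVec_mulVec hN,
      Matrix.one_mulVec])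

/-- The entries of the block matrix are dyadic (`0, 1, ±1/2`). [cite: AmyGlaudellRoss2020, §5.1] -/
theorem hadamardMat_mem_dyadicRationals (i j : Fin N) : hadamardMat N i j ∈ dyadicRationals := by
  simp only [hadamardMat, Matrix.of_apply]
  split_ifs with hi hj
  · rcases hhSign_eq_one_or ⟨i.val, hi⟩ ⟨j.val, hj⟩ with h | h <;> rw [h]
    · simpa using div_two_pow_mem_dyadicRationals 1 1
    · simpa [neg_div] using div_two_pow_mem_dyadicRationals (-1) 1
  · exact Subring.zero_mem _
  · exact Subring.one_mem _
  · exact Subring.zero_mem _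

/-- **The four-level generator `(H ⊗ H)_[0,1,2,3]`** as an element of `Γ_N` (`N ≥ 4`); the
generators `(H⊗H)_[a,b,c,d]` of Amy–Glaudell–Ross are its conjugates by permutation matrices.
[cite: AmyGlaudellRoss2020, §5.1, generator (H⊗H)_[a,b,c,d]] -/
def hadamardBlock (hN : 4 ≤ N) : dyadicOrthogonalGroup N :=
  dyadicOrthogonalGroup.mkOfMatrix (hadamardMat N)
    (by rw [hadamardMat_transpose]; exact hadamardMat_mul_self hN) hadamardMat_mem_dyadicRationals

/-- The matrix of `hadamardBlock`. [cite: AmyGlaudellRoss2020, §5.1] -/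
@[simp] theorem toMat_hadamardBlock (hN : 4 ≤ N) : toMat N (hadamardBlock hN) = hadamardMat N := rfl

/-- `hadamardBlock` is an involution. [folklore] -/
theorem hadamardBlock_mul_self (hN : 4 ≤ N) : hadamardBlock hN * hadamardBlock hN = 1 :=
  toMat_injective (by rw [map_mul, toMat_hadamardBlock, hadamardMat_mul_self hN, map_one])

/-- Action of `hadamardBlock` on a block coordinate. [cite: AmyGlaudellRoss2020, Lemma 5.2] -/
theorem hadamardBlock_mulVec_castLE (hN : 4 ≤ N) (v : Fin N → ℚ) (p : Fin 4) :
    (toMat N (hadamardBlock hN) *ᵥ v) (Fin.castLE hN p) =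
      (∑ q : Fin 4, hhSign p q * v (Fin.castLE hN q)) / 2 :=
  hadamardMat_mulVec_castLE hN v p

/-- Action of `hadamardBlock` off the block: identity. [cite: AmyGlaudellRoss2020, Lemma 5.2] -/
theorem hadamardBlock_mulVec_of_not_lt (hN : 4 ≤ N) {v : Fin N → ℚ} {j : Fin N}
    (hj : ¬ j.val < 4) : (toMat N (hadamardBlock hN) *ᵥ v) j = v j :=
  hadamardMat_mulVec_of_not_lt hj

/-- `hadamardBlock` fixes the basis vectors off the block. [cite: AmyGlaudellRoss2020, §5.1] -/
theorem hadamardBlock_mulVec_single (hN : 4 ≤ N) {j : Fin N} (hj : ¬ j.val < 4) :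
    toMat N (hadamardBlock hN) *ᵥ Pi.single j 1 = Pi.single j 1 := by
  funext i
  by_cases hi : i.val < 4
  · obtain ⟨p, rfl⟩ : ∃ p : Fin 4, Fin.castLE hN p = i := ⟨⟨i.val, hi⟩, Fin.ext rfl⟩
    rw [hadamardBlock_mulVec_castLE, Pi.single_apply, if_neg (ne_castLE_of_le hN hj p).symm]
    rw [Finset.sum_eq_zero fun q _ => ?_, zero_div]
    rw [Pi.single_apply, if_neg (ne_castLE_of_le hN hj q).symm, mul_zero]
  · exact hadamardBlock_mulVec_of_not_lt hN hi

/-- A sign change off the block commutes with the block. [cite: AmyGlaudellRoss2020, §5.1] -/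
theorem negAt_mul_hadamardBlock_comm (hN : 4 ≤ N) {i : Fin N} (hi : ¬ i.val < 4) :
    negAt i * hadamardBlock hN = hadamardBlock hN * negAt i := by
  refine ext_mulVec fun v => funext fun j => ?_
  rw [toMat_mul_mulVec, toMat_mul_mulVec, negAt_mulVec]
  by_cases hj : j.val < 4
  · obtain ⟨p, rfl⟩ : ∃ p : Fin 4, Fin.castLE hN p = j := ⟨⟨j.val, hj⟩, Fin.ext rfl⟩
    rw [if_neg (ne_castLE_of_le hN hi p).symm, hadamardBlock_mulVec_castLE,
      hadamardBlock_mulVec_castLE]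
    refine congrArg (· / 2) (Finset.sum_congr rfl fun q _ => ?_)
    rw [negAt_mulVec, if_neg (ne_castLE_of_le hN hi q).symm]
  · rw [hadamardBlock_mulVec_of_not_lt hN hj, hadamardBlock_mulVec_of_not_lt hN hj, negAt_mulVec]

/-- A permutation matrix fixing the block coordinates commutes with the block.
[cite: AmyGlaudellRoss2020, §5.1] -/
theorem permOp_mul_hadamardBlock_comm (hN : 4 ≤ N) {σ : Equiv.Perm (Fin N)}
    (hσ : ∀ j : Fin N, j.val < 4 → σ j = j) :
    permOp σ * hadamardBlock hN = hadamardBlock hN * permOp σ := by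
  have hσ' : ∀ j : Fin N, j.val < 4 → σ.symm j = j := fun j hj => by
    rw [Equiv.symm_apply_eq]
    exact (hσ j hj).symm
  have hσ'' : ∀ j : Fin N, ¬ j.val < 4 → ¬ (σ.symm j).val < 4 := fun j hj h => by
    have h1 := hσ (σ.symm j) h
    rw [Equiv.apply_symm_apply] at h1
    rw [← h1] at h
    exact hj h
  refine ext_mulVec fun v => funext fun j => ?_
  rw [toMat_mul_mulVec, toMat_mul_mulVec, permOp_mulVec]
  by_cases hj : j.val < 4
  · obtain ⟨p, rfl⟩ : ∃ p : Fin 4, Fin.castLE hN p = j := ⟨⟨j.val, hj⟩, Fin.ext rfl⟩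
    rw [hσ' _ hj, hadamardBlock_mulVec_castLE, hadamardBlock_mulVec_castLE]
    refine congrArg (· / 2) (Finset.sum_congr rfl fun q _ => ?_)
    rw [permOp_mulVec, hσ' _ (by rw [Fin.val_castLE]; exact q.isLt)]
  · rw [hadamardBlock_mulVec_of_not_lt hN (hσ'' j hj), hadamardBlock_mulVec_of_not_lt hN hj,
      permOp_mulVec]

/-- **The Hadamard relation** `(H⊗H)(I⊗X)(H⊗H) = I⊗Z` inside `Γ_N`: conjugating the double
transposition `(0 1)(2 3)` by the block gives the even sign change `(−1)_[1] (−1)_[3]`.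
[folklore] -/
theorem hadamardBlock_mul_swap_mul_hadamardBlock (hN : 4 ≤ N) :
    hadamardBlock hN * permOp (Equiv.swap (Fin.castLE hN 0) (Fin.castLE hN 1) *
        Equiv.swap (Fin.castLE hN 2) (Fin.castLE hN 3)) * hadamardBlock hN =
      negAt (Fin.castLE hN 1) * negAt (Fin.castLE hN 3) := by
  have hinj := Fin.castLE_injective hN
  set τ : Equiv.Perm (Fin N) := Equiv.swap (Fin.castLE hN 0) (Fin.castLE hN 1) *
    Equiv.swap (Fin.castLE hN 2) (Fin.castLE hN 3) with hτ_def
  have hτ : ∀ q : Fin 4, τ.symm (Fin.castLE hN q) =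
      Fin.castLE hN (Equiv.swap 2 3 (Equiv.swap 0 1 q)) := by
    intro q
    simp only [hτ_def, Equiv.Perm.mul_def, Equiv.symm_trans_apply, Equiv.symm_swap,
      hinj.swap_apply]
  refine ext_mulVec fun v => funext fun j => ?_
  simp only [toMat_mul_mulVec]
  by_cases hj : j.val < 4
  · obtain ⟨p, rfl⟩ : ∃ p : Fin 4, Fin.castLE hN p = j := ⟨⟨j.val, hj⟩, Fin.ext rfl⟩
    rw [hadamardBlock_mulVec_castLE]
    simp only [permOp_mulVec, hτ, hadamardBlock_mulVec_castLE, negAt_mulVec, hinj.eq_iff,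
      Fin.sum_univ_four]
    fin_cases p <;> simp [hhSign, Equiv.swap_apply_def] <;> ring
  · have hne := ne_castLE_of_le hN hj
    have hfix : τ.symm j = j := by
      simp [hτ_def, Equiv.Perm.mul_def, Equiv.symm_swap,
        Equiv.swap_apply_of_ne_of_ne (hne _) (hne _)]
    rw [hadamardBlock_mulVec_of_not_lt hN hj, permOp_mulVec, hfix,
      hadamardBlock_mulVec_of_not_lt hN hj, negAt_mulVec, if_neg (hne 1), negAt_mulVec,
      if_neg (hne 3)]

end Literature.Barriers.QuantumAdvantage

end
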